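import Summits.Ventures.LatticeQCDFlow.Scaling.UnitSurvivalKLogK

/-!
HONEST FRAMING: exact (Metropolis-corrected) sampling algorithms for lattice gauge theory; figures
of merit are autocorrelation/cost numbers at stated couplings and volumes; no continuum-physics
claim.

# IdealStarKLogKLaw — THE TWO-SIDED `(K/(t(1−t)))·log K` LAW OF THE IDEALISED HOT-ONLY STAR: AT UNIFORM LISTING
# (`m = cK`), `K ≥ 8`, `|S| ≥ 20(K+1)`, EXACT HOT SAMPLER, `0 < t < 1`:
# `(K/(t(1−t)) − 1)·log(K/32) ≤ t_mix(1/4) ≤ ⌈((K+t)/(t(1−t)))·log((K + b*)/(b*/4))⌉`, `b* = t(K+1)/(K+t)`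
# (lean-2 GEN-27, ours)

Venture-side (OURS).  Cell `lqcd-flow` (pub-lqcd), unit `pub-lqcd-lean-2-g27`, 2026-08-27/28.  Chapter M, the floor
side, file 11: the assembly of `Scaling/UnitSurvivalKLogK` (floor) with the third term of
`Scaling/IdealStarThreeTermLaw` (ceiling).  Setting: the idealised hot-only star — one positive unit-mass law `ν` at
every level, identity maps, hub list `e_r = (0, κ_r+1)` with every cold level listed exactly `c ≥ 1` times and
`m = cK`, hot-only updates with the exact sampler `M_0(u,·) = ν`, `ν`-reversible row-stochastic cold kernels (they
never act), `0 < t < 1`, `K ≥ 8`, `|S| ≥ 20(K+1)`.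

## What is proved

* **`idealStar_KlogK_law`** — the conjunction
  `(K/(t(1−t)) − 1)·log(K/32) ≤ t_mix(1/4)` and `t_mix(1/4) ≤ ⌈((K+t)/(t(1−t)))·log((K + b*)/(b*·(1/4)))⌉`
  with `b* = t(K+1)/(t(K+1) + (1−t)K)`.

Reading (no numerics implied): since `log((K + b*)/(b*/4)) ≤ log(4(K+1)(K+t)/t) = O(log(K/t))`, the mixing time of
the idealised star is of exact order `(K/(t(1−t)))·log K` for every fixed swap fraction `t` — the coupon-collector
logarithm IS paid, on top of the unit `K/(t(1−t))` = (capture time `K/t` of a unit of stale content by the hub) ×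
(its refresh odds `1/(1−t)`).  NOT CLAIMED: matching constants inside the logarithm (`32` below vs `O(K/t)` above);
flow-assisted schemes with imperfect maps; anything measured.  Literature grade (cell rule): OWN RESULT; nothing cited
as a fact; no new bib keys.
-/

noncomputable section

open Finset Function
open Literature.Probability.MarkovChains

namespace Summit.Ventures.LatticeQCDFlow.Scaling

variable {S : Type*} [Fintype S] [DecidableEq S] {K m : ℕ} {ν : S → ℝ} {M : Fin (K + 1) → S → S → ℝ} {t : ℝ}

section Law
variable (κ : Fin m → Fin K)

/-- **THE TWO-SIDED `(K/(t(1−t)))·log K` LAW OF THE IDEALISED HOT-ONLY STAR** (uniform listing `m = cK` with every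
cold level listed exactly `c ≥ 1` times, `K ≥ 8`, `|S| ≥ 20(K+1)`, exact hot sampler, `ν`-reversible kernels,
`0 < t < 1`): `(K/(t(1−t)) − 1)·log(K/32) ≤ t_mix(1/4) ≤ ⌈((K+t)/(t(1−t)))·log((K + b*)/(b*/4))⌉`. [ours] -/
theorem idealStar_KlogK_law (hK : 8 ≤ K) (hS : 20 * (K + 1) ≤ Fintype.card S) (ht0 : 0 < t) (ht1 : t < 1)
    (hν : ∀ v, 0 < ν v) (hν1 : ∑ v, ν v = 1) (hM : ∀ k, IsRowStochastic (M k)) (hMrev : ∀ k, DetailedBalance ν (M k))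
    (hM0 : ∀ u v, M 0 u v = ν v) {c : ℕ} (hc1 : 1 ≤ c)
    (hcu : ∀ p' : Fin K, (univ.filter (fun r : Fin m => κ r = p')).card = c) (hmc : m = c * K) :
    ((K : ℝ) / (t * (1 - t)) - 1) * Real.log (K / 32)
        ≤ (mixingTime (fun y z : Fin (K + 1) → S => t * ptGraphSwap (fun _ : Fin (K + 1) => ν)
            (fun r : Fin m => (((0 : Fin (K + 1)), (κ r).succ) : Fin (K + 1) × Fin (K + 1))) (fun _ => Equiv.refl S) y z
            + (1 - t) * prodKernel (fun k : Fin (K + 1) => if k = 0 then (1 : ℝ) else 0) M y z)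
          (tensorFun (fun _ : Fin (K + 1) => ν)) (1 / 4) : ℝ) ∧
      mixingTime (fun y z : Fin (K + 1) → S => t * ptGraphSwap (fun _ : Fin (K + 1) => ν)
            (fun r : Fin m => (((0 : Fin (K + 1)), (κ r).succ) : Fin (K + 1) × Fin (K + 1))) (fun _ => Equiv.refl S) y z
            + (1 - t) * prodKernel (fun k : Fin (K + 1) => if k = 0 then (1 : ℝ) else 0) M y z)
          (tensorFun (fun _ : Fin (K + 1) => ν)) (1 / 4)
        ≤ ⌈((K : ℝ) + t) / (t * (1 - t))
            * Real.log (((K : ℝ) + t * ((K : ℝ) + 1) / (t * ((K : ℝ) + 1) + (1 - t) * K))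
              / (t * ((K : ℝ) + 1) / (t * ((K : ℝ) + 1) + (1 - t) * K) * (1 / 4)))⌉₊ := by
  have hS4 : 4 * (K + 1) ≤ Fintype.card S := by omega
  have hc : ∀ p' : Fin K, c ≤ (univ.filter (fun r : Fin m => κ r = p')).card := fun p' => (hcu p').symm.le
  obtain ⟨_, _, hceil⟩ := idealStar_threeTerm_law κ (by omega) hS4 ht0 ht1 hν hν1 hM hMrev hM0 hc1 hc hmc
  have hm : 1 ≤ m := by rw [hmc]; exact Nat.one_le_iff_ne_zero.mpr (Nat.mul_ne_zero (by omega) (by omega))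
  have hcm : c ≤ m := by rw [hmc]; exact Nat.le_mul_of_pos_right c (by omega)
  have hμ : ∀ (k : Fin (K + 1)) (v : S), 0 < (fun _ : Fin (K + 1) => ν) k v := fun _ v => hν v
  have hμ1 : ∀ k : Fin (K + 1), ∑ u, (fun _ : Fin (K + 1) => ν) k u = 1 := fun _ => hν1
  have hM0' : ∀ u v, M 0 u v = (fun _ : Fin (K + 1) => ν) 0 v := hM0
  have hperf : ∀ (r : Fin m) (u : S), (fun _ : Fin (K + 1) => ν) (κ r).succ ((fun _ : Fin m => Equiv.refl S) r u)
      = (fun _ : Fin (K + 1) => ν) 0 u := fun _ _ => rfl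
  have hw0 : ∀ k : Fin (K + 1), 0 ≤ (if k = 0 then (1 : ℝ) else 0) := fun k => by split_ifs <;> norm_num
  have hw00 : (0 : ℝ) < (if (0 : Fin (K + 1)) = 0 then (1 : ℝ) else 0) := by rw [if_pos rfl]; norm_num
  have hw1 : ∑ k : Fin (K + 1), (if k = 0 then (1 : ℝ) else 0) = 1 := by
    rw [Finset.sum_ite_eq' univ (0 : Fin (K + 1)), if_pos (mem_univ _)]
  have hstat : ∀ k : Fin (K + 1), k ≠ 0 → ∀ v,
      ∑ u, (fun _ : Fin (K + 1) => ν) k u * M k u v = (fun _ : Fin (K + 1) => ν) k v :=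
    fun k _ v => (hMrev k).isStationary (hM k).2 v
  -- the ceiling supplies a `1/4`-close time
  have hmix : ∃ t₀, worstTvDist (fun y z : Fin (K + 1) → S => t * ptGraphSwap (fun _ : Fin (K + 1) => ν)
            (fun r : Fin m => (((0 : Fin (K + 1)), (κ r).succ) : Fin (K + 1) × Fin (K + 1))) (fun _ => Equiv.refl S) y z
            + (1 - t) * prodKernel (fun k : Fin (K + 1) => if k = 0 then (1 : ℝ) else 0) M y z)
      (tensorFun (fun _ : Fin (K + 1) => ν)) t₀ ≤ 1 / 4 :=
    ⟨_, perfectStar_worstTvDist_le_of_ge_log κ (fun _ => Equiv.refl S) (μ := fun _ : Fin (K + 1) => ν) hm ht0 ht1 hw0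
      hw00 hw1 hμ hμ1 hM hM0' hstat hperf hc1 hc hcm (by norm_num : (0:ℝ) < 1 / 4) (Nat.le_ceil _)⟩
  exact ⟨idealStar_KlogK_floor κ hK hS ht0 ht1 hν hν1 hM hMrev hM0 hc1 hcu hmc hmix, hceil⟩

end Law

end Summit.Ventures.LatticeQCDFlow.Scaling

end
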